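import Literature.Analysis.FunctionSpaces.ItoProductRule
import HarnessLib

/-!
# The product rule `d(XA) = X dA + A dX` under progressive-measurability hypotheses

Topic `Analysis/FunctionSpaces`; theorems only. The tree's product rule
`Literature.Analysis.FunctionSpaces.ae_mul_eq_of_isItoProcess` (`ItoProductRule.lean`: for an Itô
process `X = X₀ + ∫ b ds + ∫ σ dB` and a finite-variation process `A = A₀ + ∫ a ds`, almost surely
`X_t A_t = X₀ A₀ + ∫₀ᵗ (X_s a_s + A_s b_s) ds + ∫₀ᵗ σ_s A_s dB_s`) assumes that EVERY path of `X`
and of `A` is continuous, and uses this only to know that `X` and `A` are progressively measurable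
(so that the integrands `σX`, `σA` have Borel paths). Here is the same statement and the same
proof (polarisation from the one-dimensional Itô formula `ito_formula_itoProcess_ae_holds` along
`X ± A`) with the hypotheses `IsStronglyProgressive X`, `IsStronglyProgressive A` instead
(`ae_mul_eq_of_isItoProcess_of_progressive`, `IsItoProcess.mul_timeIntegral_of_progressive`):
the form needed for processes whose paths are continuous only almost surely (e.g. the point flow
of SLE(κ, ρ), whose driving function is built from a Bessel process).

## References

* D. Revuz, M. Yor, *Continuous Martingales and Brownian Motion* (3rd ed., 1999), Ch. IV,
  Prop. (3.1) (integration by parts) and Thm (3.3).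
-/

noncomputable section

open MeasureTheory Filter Set
open scoped NNReal ENNReal

namespace Literature.Analysis.FunctionSpaces

open Literature.Probability.Process Literature.Probability.RandomPlanarGeometry

variable {X b σ A a K KX : ℝ≥0 → (ℝ≥0 → ℝ) → ℝ}

/-- **The product rule, integrated form, for progressively measurable factors**
(`XA = X₀A₀ + ∫ (Xa + Ab) ds + ∫ σA dB`). Let `X = X₀ + ∫ b ds + ∫ σ dB` be an Itô process
(canonical Brownian motion, raw filtration) which is progressively measurable, with progressive
`σ`; let `A = A₀ + ∫ a ds` (every `t`, a.s.) be progressively measurable, `a` a.s. locally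
integrable; and let `K_X = ∫ σX dB`, `K = ∫ σA dB` be Itô integrals which are martingales. Then
almost surely, for all `t`, `X_t A_t = X₀A₀ + ∫₀ᵗ (X_s a_s + A_s b_s) ds + K_t`. Same proof as
`ae_mul_eq_of_isItoProcess` (polarisation along `X ± A` from `ito_formula_itoProcess_ae_holds`,
Itô integrals `2K_X ± 2K` by `IsItoIntegral.add_of_martingale` / `.sub_of_martingale`).
Revuz–Yor (1999), Ch. IV, Prop. (3.1). [cite: RevuzYor1999, Ch. IV Prop. (3.1)] -/
theorem ae_mul_eq_of_isItoProcess_of_progressive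
    (hXp : IsStronglyProgressive brownianFiltration X)
    (hσ : IsStronglyProgressive brownianFiltration σ)
    (hX : IsItoProcess X b σ brownian brownianFiltration preWienerMeasure)
    (hAp : IsStronglyProgressive brownianFiltration A)
    (hA : ∀ᵐ ω ∂preWienerMeasure, ∀ t : ℝ≥0, A t ω = A 0 ω + ∫ s in (0 : ℝ)..t, a s.toNNReal ω)
    (ha : ∀ᵐ ω ∂preWienerMeasure, ∀ t : ℝ≥0, IntegrableOn (fun s : ℝ ↦ a s.toNNReal ω) (Icc 0 t))
    (hKX : IsItoIntegral (fun t ω ↦ σ t ω * X t ω) brownian KX brownianFiltration preWienerMeasure)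
    (hKXM : Martingale KX brownianFiltration preWienerMeasure)
    (hK : IsItoIntegral (fun t ω ↦ σ t ω * A t ω) brownian K brownianFiltration preWienerMeasure)
    (hKM : Martingale K brownianFiltration preWienerMeasure) :
    ∀ᵐ ω ∂preWienerMeasure, ∀ t : ℝ≥0, X t ω * A t ω = X 0 ω * A 0 ω +
      (∫ s in (0 : ℝ)..t, (X s.toNNReal ω * a s.toNNReal ω + A s.toNNReal ω * b s.toNNReal ω)) +
      K t ω := by
  have hσX : ∀ ω, Measurable fun s : ℝ ↦ σ s.toNNReal ω * X s.toNNReal ω := fun ω ↦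
    measurable_path_of_isStronglyProgressive (hσ.mul hXp) ω
  have hσA : ∀ ω, Measurable fun s : ℝ ↦ σ s.toNNReal ω * A s.toNNReal ω := fun ω ↦
    measurable_path_of_isStronglyProgressive (hσ.mul hAp) ω
  have hXa : StronglyAdapted brownianFiltration X := hXp.stronglyAdapted
  have hAa : StronglyAdapted brownianFiltration A := hAp.stronglyAdapted
  -- the processes `X ± A`
  have hP : IsItoProcess (fun t ω ↦ X t ω + 1 * A t ω) (fun t ω ↦ b t ω + 1 * a t ω) σ brownian
      brownianFiltration preWienerMeasure := hX.add_const_mul_timeIntegral hA ha 1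
  have hM : IsItoProcess (fun t ω ↦ X t ω + (-1) * A t ω) (fun t ω ↦ b t ω + (-1) * a t ω) σ
      brownian brownianFiltration preWienerMeasure := hX.add_const_mul_timeIntegral hA ha (-1)
  have hPa : Adapted brownianFiltration fun t ω ↦ X t ω + 1 * A t ω := fun t ↦
    ((hXa t).add ((hAa t).const_mul 1)).measurable
  have hMa : Adapted brownianFiltration fun t ω ↦ X t ω + (-1) * A t ω := fun t ↦
    ((hXa t).add ((hAa t).const_mul (-1))).measurable
  have hd1 : ∀ v : ℝ, deriv (fun u : ℝ ↦ u ^ 2) v = 2 * v := fun v ↦ by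
    rw [(hasDerivAt_pow 2 v).deriv]; simp [pow_one]
  have hd2 : ∀ v : ℝ, iteratedDeriv 2 (fun u : ℝ ↦ u ^ 2) v = 2 := fun v ↦ by
    rw [iteratedDeriv_succ, iteratedDeriv_one, show deriv (fun u : ℝ ↦ u ^ 2) = fun v ↦ 2 * v from
      funext hd1, deriv_const_mul _ differentiableAt_id, deriv_id'', mul_one]
  -- Itô integrals of `2σ(X ± A)` by linearity
  have hKP : IsItoIntegral (fun t ω ↦ σ t ω * deriv ((fun (_ : ℝ) (v : ℝ) ↦ v ^ 2) t)
      (X t ω + 1 * A t ω)) brownian (fun t ω ↦ (KX t ω + K t ω) + (KX t ω + K t ω))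
      brownianFiltration preWienerMeasure := by
    have h1 := hKX.add_of_martingale hK hσX hσA hKXM hKM
    have h2 := h1.add_of_martingale h1 (fun ω ↦ (hσX ω).add (hσA ω))
      (fun ω ↦ (hσX ω).add (hσA ω)) (hKXM.add hKM) (hKXM.add hKM)
    have heq : (fun t ω ↦ σ t ω * deriv ((fun (_ : ℝ) (v : ℝ) ↦ v ^ 2) t) (X t ω + 1 * A t ω)) =
        fun t ω ↦ σ t ω * X t ω + σ t ω * A t ω + (σ t ω * X t ω + σ t ω * A t ω) := by
      funext t ω
      beta_reduce
      rw [hd1]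
      ring
    rw [heq]
    exact h2
  have hKM' : IsItoIntegral (fun t ω ↦ σ t ω * deriv ((fun (_ : ℝ) (v : ℝ) ↦ v ^ 2) t)
      (X t ω + (-1) * A t ω)) brownian (fun t ω ↦ (KX t ω - K t ω) + (KX t ω - K t ω))
      brownianFiltration preWienerMeasure := by
    have h1 := hKX.sub_of_martingale hK hσX hσA hKXM hKM
    have h2 := h1.add_of_martingale h1 (fun ω ↦ (hσX ω).sub (hσA ω))
      (fun ω ↦ (hσX ω).sub (hσA ω)) (hKXM.sub hKM) (hKXM.sub hKM)
    have heq : (fun t ω ↦ σ t ω * deriv ((fun (_ : ℝ) (v : ℝ) ↦ v ^ 2) t) (X t ω + (-1) * A t ω)) =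
        fun t ω ↦ σ t ω * X t ω - σ t ω * A t ω + (σ t ω * X t ω - σ t ω * A t ω) := by
      funext t ω
      beta_reduce
      rw [hd1]
      ring
    rw [heq]
    exact h2
  -- Itô's formula for `u²` along `X ± A`
  have hf : ContDiff ℝ 2 (Function.uncurry fun (_ : ℝ) (v : ℝ) ↦ v ^ 2) :=
    (contDiff_id.pow 2).comp contDiff_snd
  have hitoP := ito_formula_itoProcess_ae_holds (fun (_ : ℝ) (v : ℝ) ↦ v ^ 2) hf hPa hσ hP hKP
  have hitoM := ito_formula_itoProcess_ae_holds (fun (_ : ℝ) (v : ℝ) ↦ v ^ 2) hf hMa hσ hM hKM'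
  have hintP := hP.ae_integrableOn_itoDrift hf hσ
  have hintM := hM.ae_integrableOn_itoDrift hf hσ
  filter_upwards [hitoP, hitoM, hintP, hintM, hX.1, ha] with ω hP' hM' hiP hiM hb ha' t
  have h1 := hP' t
  have h2 := hM' t
  have hi1 := hiP t
  have hi2 := hiM t
  simp only [deriv_const, zero_add, hd1, hd2] at h1 h2 hi1 hi2
  -- subtract the two integrals
  have hI1 : IntervalIntegrable (fun s : ℝ ↦ (b s.toNNReal ω + 1 * a s.toNNReal ω) *
      (2 * (X s.toNNReal ω + 1 * A s.toNNReal ω)) + 2⁻¹ * σ s.toNNReal ω ^ 2 * 2) volume 0 t :=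
    (intervalIntegrable_iff_integrableOn_Icc_of_le t.coe_nonneg).2 hi1
  have hI2 : IntervalIntegrable (fun s : ℝ ↦ (b s.toNNReal ω + (-1) * a s.toNNReal ω) *
      (2 * (X s.toNNReal ω + (-1) * A s.toNNReal ω)) + 2⁻¹ * σ s.toNNReal ω ^ 2 * 2) volume 0 t :=
    (intervalIntegrable_iff_integrableOn_Icc_of_le t.coe_nonneg).2 hi2
  have hdiff : (∫ s in (0 : ℝ)..t, ((b s.toNNReal ω + 1 * a s.toNNReal ω) *
      (2 * (X s.toNNReal ω + 1 * A s.toNNReal ω)) + 2⁻¹ * σ s.toNNReal ω ^ 2 * 2)) -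
      (∫ s in (0 : ℝ)..t, ((b s.toNNReal ω + (-1) * a s.toNNReal ω) *
      (2 * (X s.toNNReal ω + (-1) * A s.toNNReal ω)) + 2⁻¹ * σ s.toNNReal ω ^ 2 * 2)) =
      4 * ∫ s in (0 : ℝ)..t, (X s.toNNReal ω * a s.toNNReal ω + A s.toNNReal ω * b s.toNNReal ω) := by
    rw [← intervalIntegral.integral_sub hI1 hI2, ← intervalIntegral.integral_const_mul]
    refine intervalIntegral.integral_congr fun s _ ↦ ?_
    ring
  linear_combination (h1 - h2 + hdiff) / 4

/-- **The product `XA` is an Itô process** with drift `X a + A b` and diffusion coefficient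
`σ A` (hypotheses of `ae_mul_eq_of_isItoProcess_of_progressive`; the drift is a.s. locally
integrable because the paths of `X` (an Itô process) and of `A` (a primitive) are almost surely
continuous). Revuz–Yor (1999), Ch. IV, Prop. (3.1). [cite: RevuzYor1999, Ch. IV Prop. (3.1)] -/
theorem IsItoProcess.mul_timeIntegral_of_progressive
    (hXp : IsStronglyProgressive brownianFiltration X)
    (hσ : IsStronglyProgressive brownianFiltration σ)
    (hX : IsItoProcess X b σ brownian brownianFiltration preWienerMeasure)
    (hAp : IsStronglyProgressive brownianFiltration A)
    (hA : ∀ᵐ ω ∂preWienerMeasure, ∀ t : ℝ≥0, A t ω = A 0 ω + ∫ s in (0 : ℝ)..t, a s.toNNReal ω)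
    (ha : ∀ᵐ ω ∂preWienerMeasure, ∀ t : ℝ≥0, IntegrableOn (fun s : ℝ ↦ a s.toNNReal ω) (Icc 0 t))
    (hKX : IsItoIntegral (fun t ω ↦ σ t ω * X t ω) brownian KX brownianFiltration preWienerMeasure)
    (hKXM : Martingale KX brownianFiltration preWienerMeasure)
    (hK : IsItoIntegral (fun t ω ↦ σ t ω * A t ω) brownian K brownianFiltration preWienerMeasure)
    (hKM : Martingale K brownianFiltration preWienerMeasure) :
    IsItoProcess (fun t ω ↦ X t ω * A t ω) (fun t ω ↦ X t ω * a t ω + A t ω * b t ω)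
      (fun t ω ↦ σ t ω * A t ω) brownian brownianFiltration preWienerMeasure := by
  refine ⟨?_, K, hK, ae_mul_eq_of_isItoProcess_of_progressive hXp hσ hX hAp hA ha hKX hKXM hK hKM⟩
  -- a.s. continuity of the paths of `A` (a primitive of an a.s. locally integrable function)
  have hAc : ∀ᵐ ω ∂preWienerMeasure, Continuous fun t : ℝ≥0 ↦ A t ω := by
    filter_upwards [hA, ha] with ω hAω haω
    have hF : Continuous fun x : ℝ ↦ ∫ s in (0 : ℝ)..x, a s.toNNReal ω :=
      intervalIntegral.continuous_primitive
        (intervalIntegrable_of_forall_integrableOn_Icc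
          (fun s hs ↦ by simp [Real.toNNReal_of_nonpos hs]) haω) 0
    have heq : (fun t : ℝ≥0 ↦ A t ω) = fun t : ℝ≥0 ↦ A 0 ω + ∫ s in (0 : ℝ)..t, a s.toNNReal ω :=
      funext (hAω)
    rw [heq]
    exact continuous_const.add (hF.comp NNReal.continuous_coe)
  filter_upwards [hX.1, ha, hX.ae_continuous, hAc] with ω hb ha' hXc hAc' t
  have hXi : ContinuousOn (fun s : ℝ ↦ X s.toNNReal ω) (Icc 0 t) :=
    (hXc.comp continuous_real_toNNReal).continuousOn
  have hAi : ContinuousOn (fun s : ℝ ↦ A s.toNNReal ω) (Icc 0 t) :=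
    (hAc'.comp continuous_real_toNNReal).continuousOn
  exact ((ha' t).continuousOn_mul hXi isCompact_Icc).add ((hb t).continuousOn_mul hAi isCompact_Icc)

end Literature.Analysis.FunctionSpaces
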